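import Literature.Computability.ImplicitComplexity.SoftTypeAssignmentGeneration
import Literature.Computability.ImplicitComplexity.SoftTypeAssignmentRemap
import Mathlib.Algebra.BigOperators.Group.Finset.Basic
import Mathlib.Algebra.Order.BigOperators.Group.Finset
import HarnessLib

/-!
# The substitution lemma of `STA₊` (GR07/GMR08), I: families of substituends and the easy rules

Subject reduction for `STA`/`STA₊` rests on the Substitution Lemma of Gaboardi–Ronchi Della
Rocca 2007 (GR07; GMR08 = Gaboardi–Marion–Ronchi Della Rocca 2008 inherits it, §5: "The subject
reduction property can be immediately derived by the corresponding property of STA"): from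
`Γ, x : !ᵏB ⊢ P : τ` and a box `!ᵏΔ₀ ⊢ N : !ᵏB` one derives `Γ, !ᵏΔ₀ ⊢ P[N/x] : τ`, with the weight
bounded by `W(P) + W(N)` (GMR08 Lemma 5.5/5.6 machinery). Because the multiplexor `(m)` turns ONE
assumption `x : !σ` into several `x₁, …, xₙ : σ` above it, the lemma has to be proved for the
simultaneous substitution of a FAMILY of terms for a finite set of slots; this file sets up that
induction:

* `STA.famSubst X N` — the simultaneous substitution `xᵢ ↦ Nᵢ (i ∈ X)`;
* `STA.Family r Θ X N Δ c ℓ wt e` — the data substituted into a judgement with context `Θ`: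
  for each slot `x ∈ X` (declared in `Θ` with `ℓ x` modalities, `Θ x = !^{ℓ x} Bₓ`) a TIGHT
  level-`0` derivation `Δₓ ⊢ Nₓ : Bₓ` of weight `wt x` and degree `e x`, the contexts `Δₓ` being
  the parts (`Ctx.part`, owner map `c`) of one context `Δ` disjoint from `Θ`; in the conclusion the
  part owned by `x` appears promoted `ℓ x` times (`Ctx.levelled`), giving the result context
  `STA.resCtx` = (`Θ` minus `X`) ⊎ levelled `Δ`;
* `STA.SubstGoal r w d Θ P τ` — the conclusion of the lemma for a main judgement `Θ ⊢ P : τ` of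
  weight `w` and degree `d`: the substituted term is typable in the result context with weight
  `≤ w + Σₓ r^{ℓ x} · wt x` (`STA.famCost`) and degree `≤ max d (maxₓ (e x + ℓ x))` (`STA.famDeg`);
* the cases `(Ax)`, `(w)`, `(∀E)`, `(sum)` of the induction (`SubstGoal.ax`, `.weak`, `.allE`,
  `.sum`). The remaining rules are in the sequel files; the lemma itself and subject reduction in
  `SoftTypeAssignmentSubjectReduction.lean`.

## References

* [GaboardiRonchiDellaRocca2007] GR07, Substitution Lemma.
* [GaboardiMarionRonchidellarocca2008] GMR08, §3.1 (Lemma 3.3/3.4), §5 (Lemma 5.5, 5.6).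
-/

namespace Literature.Computability.ImplicitComplexity

namespace STA

open Finset

/-! ### Simultaneous substitution of a family -/

/-- The simultaneous substitution `i ↦ Nᵢ` for `i ∈ X`, identity elsewhere. [folklore] -/
def famSubst (X : Finset ℕ) (N : ℕ → Term) : ℕ → Term := fun i => if i ∈ X then N i else .var i

/-- Value of the family substitution on a substituted slot. [folklore] -/
theorem famSubst_of_mem {X : Finset ℕ} (N : ℕ → Term) {i : ℕ} (h : i ∈ X) : famSubst X N i = N i := by
  simp [famSubst, h]

/-- Value of the family substitution elsewhere. [folklore] -/
theorem famSubst_of_not_mem {X : Finset ℕ} (N : ℕ → Term) {i : ℕ} (h : i ∉ X) :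
    famSubst X N i = .var i := by
  simp [famSubst, h]

/-- The empty family substitutes nothing. [folklore] -/
theorem famSubst_empty (N : ℕ → Term) : famSubst ∅ N = Term.var := by
  funext i
  simp [famSubst]

/-- The family shifted under one binder. [folklore] -/
def shiftFam (N : ℕ → Term) : ℕ → Term
  | 0 => .var 0
  | i + 1 => (N i).rename Nat.succ

/-- Lifting the family substitution under a binder is the substitution of the shifted family for
the shifted slots. [folklore] -/
theorem up_famSubst (X : Finset ℕ) (N : ℕ → Term) :
    Term.up (famSubst X N) = famSubst (X.image Nat.succ) (shiftFam N) := by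
  funext i
  cases i with
  | zero =>
    have : (0 : ℕ) ∉ X.image Nat.succ := by simp
    simp [Term.up, famSubst, this]
  | succ i =>
    by_cases h : i ∈ X
    · have : i + 1 ∈ X.image Nat.succ := mem_image.2 ⟨i, h, rfl⟩
      simp [Term.up, famSubst, h, this, shiftFam]
    · have : i + 1 ∉ X.image Nat.succ := by simpa using h
      simp [Term.up, famSubst, h, this, Term.rename]

/-! ### Families of substituends -/

/-- The part of `Δ` owned by `x` under the owner map `c`. [folklore] -/
def Ctx.part (Δ : Ctx) (c : ℕ → ℕ) (x : ℕ) : Ctx := fun i => if c i = x then Δ i else none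

/-- `Δ` with each slot promoted as many times as its owner's level. [folklore] -/
def Ctx.levelled (Δ : Ctx) (c ℓ : ℕ → ℕ) : Ctx := fun i =>
  (Δ i).map fun τ => ⟨τ.bangs + ℓ (c i), τ.lin⟩

/-- The context of the conclusion of the substitution lemma: the main context without the
substituted slots, plus the levelled contexts of the substituends. [cite: GaboardiRonchiDellaRocca2007, Substitution Lemma] -/
def resCtx (Θ : Ctx) (X : Finset ℕ) (Δ : Ctx) (c ℓ : ℕ → ℕ) : Ctx := fun i =>
  if i ∈ X then none else (Θ i).or (Δ.levelled c ℓ i)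

/-- Value of the levelled context. [folklore] -/
@[simp] theorem Ctx.levelled_apply (Δ : Ctx) (c ℓ : ℕ → ℕ) (i : ℕ) :
    Δ.levelled c ℓ i = (Δ i).map fun τ => ⟨τ.bangs + ℓ (c i), τ.lin⟩ := rfl

/-- Value of the part owned by `x`. [folklore] -/
@[simp] theorem Ctx.part_apply (Δ : Ctx) (c : ℕ → ℕ) (x i : ℕ) :
    Δ.part c x i = if c i = x then Δ i else none := rfl

/-- Value of the result context. [folklore] -/
theorem resCtx_apply (Θ : Ctx) (X : Finset ℕ) (Δ : Ctx) (c ℓ : ℕ → ℕ) (i : ℕ) :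
    resCtx Θ X Δ c ℓ i = if i ∈ X then none else (Θ i).or (Δ.levelled c ℓ i) := rfl

/-- A **family of substituends** for a judgement with context `Θ`: for each slot `x ∈ X`, declared
in `Θ` as `!^{ℓ x} Bₓ`, a tight level-`0` derivation `Δₓ ⊢ Nₓ : Bₓ` of weight `wt x` and degree
`e x`, the `Δₓ = Δ.part c x` being parts of one context `Δ` disjoint from `Θ` all of whose slots
are owned by members of `X`. [cite: GaboardiRonchiDellaRocca2007, Substitution Lemma] -/
structure Family (r : ℕ) (Θ : Ctx) (X : Finset ℕ) (N : ℕ → Term) (Δ : Ctx) (c ℓ wt e : ℕ → ℕ) : Prop where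
  /-- the substituend of slot `x` is typed, at level `0`, by the linear kernel of the slot's type -/
  deriv : ∀ x ∈ X, ∃ B, Θ x = some ⟨ℓ x, B⟩ ∧ WTyping r (wt x) (e x) (Δ.part c x) (N x) ⟨0, B⟩
  /-- every declared slot of a substituend's context is free in the substituend -/
  tight : ∀ x ∈ X, (Δ.part c x).Tight (N x)
  /-- the substituends' slots are not slots of the main context -/
  disjoint : ∀ i, Δ i ≠ none → Θ i = none
  /-- every slot of `Δ` is owned by a substituted slot -/
  owned : ∀ i, Δ i ≠ none → c i ∈ X

/-- The weight contributed by a family: `Σₓ r^{ℓ x} · wt x`. [cite: GaboardiMarionRonchidellarocca2008, Lemma 5.5] -/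
def famCost (r : ℕ) (X : Finset ℕ) (ℓ wt : ℕ → ℕ) : ℕ := ∑ x ∈ X, r ^ ℓ x * wt x

/-- The degree bound contributed by a family: `maxₓ (e x + ℓ x)`. [folklore] -/
def famDeg (X : Finset ℕ) (ℓ e : ℕ → ℕ) : ℕ := X.sup fun x => e x + ℓ x

/-- **Conclusion of the substitution lemma** for a main judgement `Θ ⊢ P : τ` of weight `w` and
degree `d`: every family can be substituted, the result being typed in `resCtx` with weight
`≤ w + famCost` and degree `≤ max d famDeg`. [cite: GaboardiRonchiDellaRocca2007, Substitution Lemma] -/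
def SubstGoal (r w d : ℕ) (Θ : Ctx) (P : Term) (τ : SoftTy) : Prop :=
  ∀ ⦃X : Finset ℕ⦄ ⦃N : ℕ → Term⦄ ⦃Δ : Ctx⦄ ⦃c ℓ wt e : ℕ → ℕ⦄, Family r Θ X N Δ c ℓ wt e →
    ∃ w' d', w' ≤ w + famCost r X ℓ wt ∧ d' ≤ max d (famDeg X ℓ e) ∧
      WTyping r w' d' (resCtx Θ X Δ c ℓ) (P.substp (famSubst X N)) τ

namespace Family

variable {r : ℕ} {Θ : Ctx} {X : Finset ℕ} {N : ℕ → Term} {Δ : Ctx} {c ℓ wt e : ℕ → ℕ}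

/-- Substituted slots are declared. [folklore] -/
theorem declared (F : Family r Θ X N Δ c ℓ wt e) {x : ℕ} (hx : x ∈ X) : Θ x ≠ none := by
  obtain ⟨B, hB, _⟩ := F.deriv x hx
  simp [hB]

/-- Slots of the main context are not slots of the substituends. [folklore] -/
theorem Δ_eq_none (F : Family r Θ X N Δ c ℓ wt e) {i : ℕ} (hi : Θ i ≠ none) : Δ i = none := by
  by_contra h
  exact hi (F.disjoint i h)

/-- A slot of a substituend's context is free in that substituend. [folklore] -/
theorem mem_fv (F : Family r Θ X N Δ c ℓ wt e) {i : ℕ} (hi : Δ i ≠ none) : i ∈ (N (c i)).fv :=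
  F.tight (c i) (F.owned i hi) i (by simpa using hi)

/-- The slots of `Δ` lie in the finite set of free variables of the substituends. [folklore] -/
theorem mem_biUnion_fv (F : Family r Θ X N Δ c ℓ wt e) {i : ℕ} (hi : Δ i ≠ none) :
    i ∈ X.biUnion fun x => (N x).fv :=
  mem_biUnion.2 ⟨c i, F.owned i hi, F.mem_fv hi⟩

/-- Changing the main context on slots that are neither substituted nor substituend slots.
[folklore] -/
theorem rebase (F : Family r Θ X N Δ c ℓ wt e) {Θ' : Ctx} (h₁ : ∀ x ∈ X, Θ' x = Θ x)
    (h₂ : ∀ i, Δ i ≠ none → Θ' i = none) : Family r Θ' X N Δ c ℓ wt e where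
  deriv x hx := by rw [h₁ x hx]; exact F.deriv x hx
  tight := F.tight
  disjoint := h₂
  owned := F.owned

/-- Restricting a family to a subset of the substituted slots (the other substituends and their
contexts are dropped). [folklore] -/
theorem restrict (F : Family r Θ X N Δ c ℓ wt e) {Y : Finset ℕ} (hY : Y ⊆ X) {Θ' : Ctx}
    (h₁ : ∀ x ∈ Y, Θ' x = Θ x) (h₂ : ∀ i, Δ i ≠ none → c i ∈ Y → Θ' i = none) :
    Family r Θ' Y N (fun i => if c i ∈ Y then Δ i else none) c ℓ wt e where
  deriv x hx := by
    obtain ⟨B, hB, hD⟩ := F.deriv x (hY hx)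
    refine ⟨B, by rw [h₁ x hx, hB], hD.of_eq_ctx ?_⟩
    funext i
    by_cases h : c i = x <;> simp [h, hx]
  tight x hx i hi := by
    refine F.tight x (hY hx) i ?_
    simp only [Ctx.part_apply] at hi ⊢
    by_cases h : c i = x
    · simpa [h, hx] using hi
    · simp [h] at hi
  disjoint i hi := by
    by_cases h : c i ∈ Y
    · exact h₂ i (by simpa [h] using hi) h
    · simp [h] at hi
  owned i hi := by
    by_cases h : c i ∈ Y
    · exact h
    · simp [h] at hi

end Family

/-! ### Cost and degree bookkeeping -/

/-- The cost is monotone in the set of slots. [folklore] -/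
theorem famCost_mono (r : ℕ) {X Y : Finset ℕ} (h : Y ⊆ X) (ℓ wt : ℕ → ℕ) :
    famCost r Y ℓ wt ≤ famCost r X ℓ wt :=
  sum_le_sum_of_subset h

/-- The degree bound is monotone in the set of slots. [folklore] -/
theorem famDeg_mono {X Y : Finset ℕ} (h : Y ⊆ X) (ℓ e : ℕ → ℕ) : famDeg Y ℓ e ≤ famDeg X ℓ e :=
  sup_mono h

/-- A single substituend costs at most the whole family. [folklore] -/
theorem le_famCost (r : ℕ) {X : Finset ℕ} {x : ℕ} (hx : x ∈ X) (ℓ wt : ℕ → ℕ) :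
    r ^ ℓ x * wt x ≤ famCost r X ℓ wt :=
  single_le_sum (f := fun x => r ^ ℓ x * wt x) (fun _ _ => Nat.zero_le _) hx

/-- A single substituend's degree is below the family's bound. [folklore] -/
theorem le_famDeg {X : Finset ℕ} {x : ℕ} (hx : x ∈ X) (ℓ e : ℕ → ℕ) : e x + ℓ x ≤ famDeg X ℓ e :=
  le_sup (f := fun x => e x + ℓ x) hx

namespace SubstGoal

variable {r : ℕ}

/-! ### Case `(Ax)` -/

/-- The substitution lemma at an axiom: either the variable is substituted (the result is the
substituend's own derivation) or nothing happens. [cite: GaboardiRonchiDellaRocca2007, Substitution Lemma] -/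
theorem ax {Θ : Ctx} {i : ℕ} {A : LinTy} (h : Θ.IsSingleton i ⟨0, A⟩) : SubstGoal r 1 0 Θ (.var i) ⟨0, A⟩ := by
  intro X N Δ c ℓ wt e F
  have hX : ∀ x ∈ X, x = i := fun x hx => by
    by_contra hne
    exact F.declared hx (h.2 x hne)
  by_cases hi : i ∈ X
  · obtain ⟨B, hB, hD⟩ := F.deriv i hi
    rw [h.1] at hB
    simp only [Option.some.injEq, SoftTy.mk.injEq] at hB
    obtain ⟨hℓ, rfl⟩ := hB
    refine ⟨wt i, e i, ?_, ?_, ?_⟩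
    · have := le_famCost r hi ℓ wt
      rw [← hℓ, pow_zero, one_mul] at this
      omega
    · exact (Nat.le_add_right _ _).trans ((le_famDeg hi ℓ e).trans (le_max_right _ _))
    · have eT : (Term.var i).substp (famSubst X N) = N i := by simp [Term.substp, famSubst, hi]
      rw [eT]
      refine hD.of_eq_ctx (funext fun j => ?_)
      by_cases hj : j ∈ X
      · obtain rfl := hX j hj
        simp [resCtx_apply, hj, F.Δ_eq_none (i := j) (by rw [h.1]; simp)]
      · have hji : j ≠ i := fun e => hj (e ▸ hi)
        rw [resCtx_apply, if_neg hj, h.2 j hji, Option.none_or, Ctx.part_apply, Ctx.levelled_apply]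
        cases hΔ : Δ j with
        | none => simp
        | some τ =>
          have hc : c j = i := hX _ (F.owned j (by simp [hΔ]))
          simp [hc, ← hℓ]
  · have hX0 : X = ∅ := eq_empty_of_forall_notMem fun x hx => hi (hX x hx ▸ hx)
    subst hX0
    refine ⟨1, 0, by simp, by simp, ?_⟩
    rw [famSubst_empty, Term.substp_var]
    refine (WTyping.ax h).of_eq_ctx (funext fun j => ?_)
    have hΔ : Δ j = none := by
      by_contra hne
      simpa using F.owned j hne
    simp [resCtx_apply, hΔ]

/-! ### Case `(w)` -/

/-- The substitution lemma through a weakening. [cite: GaboardiRonchiDellaRocca2007, Substitution Lemma] -/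
theorem weak {w d : ℕ} {Θ₀ : Ctx} {P : Term} {τ : SoftTy} (E₀ : WTyping r w d Θ₀ P τ) {j : ℕ}
    (hj : Θ₀ j = none) (A : LinTy) (IH : SubstGoal r w d Θ₀ P τ) :
    SubstGoal r w d (Function.update Θ₀ j (some ⟨0, A⟩)) P τ := by
  intro X N Δ c ℓ wt e F
  have hjP : j ∉ P.fv := E₀.not_mem_fv_of_eq_none hj
  have hΔj : Δ j = none := F.Δ_eq_none (by simp)
  by_cases hjX : j ∈ X
  · -- the weakened slot is substituted: it does not occur, drop its substituend and weaken back
    have F' := F.restrict (erase_subset j X) (Θ' := Θ₀)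
      (fun x hx => by rw [Function.update_of_ne (ne_of_mem_erase hx)])
      (fun i hi _ => by
        have h0 := F.disjoint i hi
        by_cases hij : i = j
        · subst hij; exact hj
        · rwa [Function.update_of_ne hij] at h0)
    obtain ⟨w', d', hw', hd', hD⟩ := IH F'
    refine ⟨w', d', hw'.trans (Nat.add_le_add_left (famCost_mono r (erase_subset j X) ℓ wt) _),
      hd'.trans (max_le_max le_rfl (famDeg_mono (erase_subset j X) ℓ e)), ?_⟩
    have eT : P.substp (famSubst (X.erase j) N) = P.substp (famSubst X N) :=
      Term.substp_congr_fv fun i hi => by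
        have hij : i ≠ j := fun e => hjP (e ▸ hi)
        simp [famSubst, hij]
    rw [eT] at hD
    -- add back the (unused) levelled context of the dropped substituend
    have hD' := hD.weaken_join (fun i => if c i = j then Δ.levelled c ℓ i else none) (N j).fv
      (fun i hi => by
        by_cases hc : c i = j
        · have hΔ : Δ i ≠ none := by simpa [hc] using hi
          exact hc ▸ F.mem_fv hΔ
        · simp [hc] at hi)
    refine hD'.of_eq_ctx (funext fun i => ?_)
    by_cases hij : i = j
    · subst hij
      simp [Ctx.join, resCtx_apply, hjX, hj, hΔj]
    · have eupd : Function.update Θ₀ j (some ⟨0, A⟩) i = Θ₀ i := Function.update_of_ne hij _ _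
      by_cases hiX : i ∈ X
      · have hΔ : Δ i = none := F.Δ_eq_none (F.declared hiX)
        simp [Ctx.join, resCtx_apply, hiX, hij, hΔ]
      · cases hΘ : Θ₀ i with
        | some σ => simp [Ctx.join, resCtx_apply, hiX, eupd, hΘ]
        | none =>
          cases hΔ : Δ i with
          | none => simp [Ctx.join, resCtx_apply, hiX, eupd, hΘ, hΔ]
          | some τ₀ =>
            by_cases hc : c i = j
            · simp [Ctx.join, resCtx_apply, hiX, eupd, hΘ, hΔ, hc]
            · have hcX : c i ∈ X := F.owned i (by simp [hΔ])
              simp [Ctx.join, resCtx_apply, hiX, eupd, hΘ, hΔ, hc, hcX]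
  · -- the weakened slot is kept: substitute below, weaken again
    have F' := F.rebase (Θ' := Θ₀) (fun x hx => by
        rw [Function.update_of_ne (show x ≠ j from fun e => hjX (e ▸ hx))])
      (fun i hi => by
        have h0 := F.disjoint i hi
        by_cases hij : i = j
        · subst hij; exact hj
        · rwa [Function.update_of_ne hij] at h0)
    obtain ⟨w', d', hw', hd', hD⟩ := IH F'
    refine ⟨w', d', hw', hd', ?_⟩
    have hRj : resCtx Θ₀ X Δ c ℓ j = none := by simp [resCtx_apply, hjX, hj, hΔj]
    refine (hD.weaken hRj ⟨0, A⟩).of_eq_ctx (funext fun i => ?_)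
    by_cases hij : i = j
    · subst hij
      simp [resCtx_apply, hjX, hΔj]
    · rw [Function.update_of_ne hij, resCtx_apply, resCtx_apply, Function.update_of_ne hij]

/-! ### Case `(∀E)` -/

/-- The substitution lemma through an `(∀E)`. [cite: GaboardiRonchiDellaRocca2007, Substitution Lemma] -/
theorem allE {w d : ℕ} {Θ : Ctx} {P : Term} {B : LinTy} (A : LinTy) (IH : SubstGoal r w d Θ P ⟨0, .all B⟩) :
    SubstGoal r w d Θ P ⟨0, B.inst A⟩ := by
  intro X N Δ c ℓ wt e F
  obtain ⟨w', d', hw', hd', hD⟩ := IH F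
  exact ⟨w', d', hw', hd', WTyping.allE A hD⟩

/-! ### Case `(sum)` -/

/-- The substitution lemma through a `(sum)`: both branches receive the SAME family (this is
where the weight `max W₁ W₂ + 1` of `(sum)` is needed). [cite: GaboardiMarionRonchidellarocca2008, Table 5 and Lemma 5.5] -/
theorem sum {w₁ w₂ d₁ d₂ : ℕ} {Θ : Ctx} {P Q : Term} {A : LinTy} (IH₁ : SubstGoal r w₁ d₁ Θ P ⟨0, A⟩)
    (IH₂ : SubstGoal r w₂ d₂ Θ Q ⟨0, A⟩) :
    SubstGoal r (max w₁ w₂ + 1) (max d₁ d₂) Θ (.sum P Q) ⟨0, A⟩ := by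
  intro X N Δ c ℓ wt e F
  obtain ⟨w₁', d₁', hw₁, hd₁, hD₁⟩ := IH₁ F
  obtain ⟨w₂', d₂', hw₂, hd₂, hD₂⟩ := IH₂ F
  refine ⟨max w₁' w₂' + 1, max d₁' d₂', ?_, ?_, WTyping.sum hD₁ hD₂⟩
  · have := max_le_max hw₁ hw₂
    rw [Nat.add_max_add_right] at this
    omega
  · exact max_le (hd₁.trans (max_le_max (le_max_left _ _) le_rfl))
      (hd₂.trans (max_le_max (le_max_right _ _) le_rfl))

end SubstGoal

end STA

end Literature.Computability.ImplicitComplexity
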